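import Literature.NumberTheory.LFunctions.VerjovskyCriterionNecessityProofs
import Literature.NumberTheory.LFunctions.QuasiRHInvZetaBound
import Literature.NumberTheory.LFunctions.ZetaOneLineBounds
import Literature.NumberTheory.LFunctions.ZetaTrivialStripBound
import HarnessLib

/-!
RH-EQUIVALENT family (σ-indexed quasi-RH form; the statements proved are implications «zero-free
half-plane ⟹ rate», and the named fact `Verjovsky1994_thmB2` is DISCHARGED; nothing here bears on
the truth of RH). # Verjovsky 1994, Theorem B 2) for `C_c²(ℝ₊ˣ)`: the necessity half

Companion of `VerjovskyCriterionNecessityProofs.lean` (the RH case, Theorem B 1)). The same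
Mellin-inversion road (Verjovsky §§2–3; Zagier 1981 §1) with the zero-free half-plane
`re s > θ₀` in place of RH: the inputs are the tree's quasi-RH Littlewood bound
`InvZetaQuasiRH.norm_inv_riemannZeta_le_rpow` (`1/ζ(σ+it) ≪ |t|^ε` for `σ > θ₀`, Titchmarsh
(14.2.6) for a zero-free half-plane) and UNCONDITIONAL growth of `ζ`:
`|ζ(σ+it)| ≤ C |t|^{1/2−σ₁+ε}` for `σ ≥ σ₁` (`−1/2 ≤ σ₁ ≤ 0`, `|t| ≥ 3`) from (4.11.2)
(`SelbergMollifier.norm_riemannZeta_le_sqrt`), Titchmarsh Thm 3.5 / (3.5.3)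
(`ZetaOneLine.norm_riemannZeta_le_log`, `ZetaOneLine.norm_riemannZeta_le_rpow_mul_log`), the
functional equation (`ZetaArgBacklund.norm_riemannZeta_le_fe`) and `|ζ| ≤ ζ(2)` on `re ≥ 2`.

* `Literature.NumberTheory.LFunctions.VerjovskyNecessity.exists_norm_riemannZeta_le_uncond` —
  the unconditional growth bound;
* `Literature.NumberTheory.LFunctions.VerjovskyNecessity.verjovskyRate_of_zeroFree` — if
  `ζ(s) ≠ 0` for `re s > θ₀` (`1/2 ≤ θ₀ < 1`), then for every `f ∈ C_c²(ℝ₊ˣ)` and small `ε > 0`,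
  `m_y(f) − m₀(f) = O(y^{1−θ₀/2−ε})` at `0⁺`;
* `Literature.NumberTheory.LFunctions.Verjovsky1994_thmB2.mp_holds`,
  `Literature.NumberTheory.LFunctions.Verjovsky1994_thmB2_holds` — the named fact (p. 597, Thm B 2))
  with both halves proved (`.mpr_holds` is in `VerjovskyCriterionSufficiencyProofs.lean`).

## References

* A. Verjovsky, *Discrete measures and the Riemann hypothesis*, Kodai Math. J. 17 (1994)
  596–608, Thm B 2) p. 597, p. 604 [Verjovsky1994].
* E. C. Titchmarsh, *The Theory of the Riemann Zeta-Function* (1986), Thm 14.2, Thm 3.5,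
  (4.11.2), (4.12.3) [Titchmarsh1986].
-/

noncomputable section

open Real Complex MeasureTheory Set Filter Asymptotics Topology

namespace Literature.NumberTheory.LFunctions

namespace VerjovskyNecessity

/-! ### Unconditional growth of `ζ` on `re w ≥ σ₁`, `−1/2 ≤ σ₁ ≤ 0` -/

/-- `log|t| ≤ |t|^ε/ε`. [folklore] -/
private theorem log_abs_le_rpow {t ε : ℝ} (hε : 0 < ε) : Real.log |t| ≤ |t| ^ ε / ε :=
  Real.log_le_rpow_div (abs_nonneg t) hε

/-- **Unconditional growth of `ζ`**: for `−1/2 ≤ σ₁ ≤ 0` and `0 < ε ≤ 1/4` there is `C` with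
`‖ζ(w)‖ ≤ C |Im w|^{1/2 − σ₁ + ε}` whenever `Re w ≥ σ₁` and `|Im w| ≥ 3` ((4.11.2) for
`1/2 ≤ Re w ≤ 2`, `ζ(2)` beyond, and the functional equation with Thm 3.5 / (3.5.3) for
`Re w < 1/2`). [cite: Titchmarsh1986, eq. (4.11.2), (4.12.3), Thm 3.5, (3.5.3)] -/
theorem exists_norm_riemannZeta_le_uncond {σ₁ ε : ℝ} (hσ₁ : -1 / 2 ≤ σ₁) (hσ₁' : σ₁ ≤ 0)
    (hε : 0 < ε) (hε1 : ε ≤ 1 / 4) :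
    ∃ C : ℝ, 0 < C ∧ ∀ w : ℂ, σ₁ ≤ w.re → 3 ≤ |w.im| →
      ‖riemannZeta w‖ ≤ C * |w.im| ^ (1 / 2 - σ₁ + ε) := by
  refine ⟨9 * Real.exp (1 / 2) * (21 / ε), by positivity, fun w hw ht ↦ ?_⟩
  set σ : ℝ := w.re with hσ
  set t : ℝ := w.im with htdef
  have hw : w = (σ : ℂ) + t * I := (re_add_im w).symm
  have ht1 : 1 ≤ |t| := by linarith
  have ht0 : 0 < |t| := by linarith
  have hE : 1 ≤ Real.exp (1 / 2) := Real.one_le_exp (by norm_num)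
  have hε21 : (1 : ℝ) ≤ 21 / ε := by rw [le_div_iff₀ hε]; linarith
  have hmono : ∀ a b : ℝ, a ≤ b → |t| ^ a ≤ |t| ^ b := fun a b hab ↦
    Real.rpow_le_rpow_of_exponent_le ht1 hab
  have hbig : ∀ a : ℝ, a ≤ 1 / 2 - σ₁ + ε → ∀ K : ℝ, 0 ≤ K → K ≤ 9 * Real.exp (1 / 2) * (21 / ε) →
      K * |t| ^ a ≤ 9 * Real.exp (1 / 2) * (21 / ε) * |t| ^ (1 / 2 - σ₁ + ε) := by
    intro a ha K hK0 hK
    exact mul_le_mul hK (hmono a _ ha) (Real.rpow_nonneg ht0.le _) (by positivity)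
  have hlogt : Real.log |t| ≤ |t| ^ ε / ε := log_abs_le_rpow hε
  have hlog0 : 0 < Real.log |t| := Real.log_pos (by linarith)
  rcases le_or_gt (2 : ℝ) σ with h2 | h2
  · -- `σ ≥ 2`
    have h := ZetaArgBacklund.norm_riemannZeta_le_exp_of_two_le (w := w) (by rw [← hσ]; exact h2)
    have hexp : Real.exp 0.4978 ≤ Real.exp (1 / 2) := Real.exp_le_exp.2 (by norm_num)
    have h1 : (1 : ℝ) ≤ |t| ^ (1 / 2 - σ₁ + ε) := Real.one_le_rpow ht1 (by linarith)
    calc ‖riemannZeta w‖ ≤ Real.exp (1 / 2) * 1 := by linarith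
      _ ≤ 9 * Real.exp (1 / 2) * (21 / ε) * |t| ^ (1 / 2 - σ₁ + ε) := by
          have : Real.exp (1 / 2) ≤ 9 * Real.exp (1 / 2) * (21 / ε) := by nlinarith
          exact mul_le_mul this h1 zero_le_one (by positivity)
  rcases le_or_gt (1 / 2 : ℝ) σ with h12 | h12
  · -- `1/2 ≤ σ < 2`: (4.11.2)
    have h := norm_riemannZeta_le_sqrt_abs h12 h2.le (by linarith : 2 ≤ |t|)
    rw [← hw] at h
    refine h.trans (hbig (1 / 2) (by linarith) 9 (by norm_num) ?_)
    nlinarith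
  -- `σ < 1/2`: functional equation
  have hfe := ZetaArgBacklund.norm_riemannZeta_le_fe (σ := σ) (t := t) (by linarith) h12.le
    (by linarith)
  rw [← hw] at hfe
  have hexp : 0 ≤ 1 / 2 - σ := by linarith
  have hchi : (|t| / (2 * π)) ^ (1 / 2 - σ) ≤ |t| ^ (1 / 2 - σ) := by
    refine Real.rpow_le_rpow (by positivity) ?_ hexp
    rw [div_le_iff₀ (by positivity)]
    nlinarith [Real.pi_gt_three]
  rcases le_or_gt (0 : ℝ) σ with h0 | h0
  · -- `0 ≤ σ < 1/2`: `ζ(1-σ+it)` by (3.5.3): `≤ 8 |t|^{σ} log|t|`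
    have hz : ‖riemannZeta (1 - σ + t * I)‖ ≤ 8 * |t| ^ σ * Real.log |t| := by
      have := ZetaOneLine.norm_riemannZeta_le_rpow_mul_log (s := (1 - σ : ℝ) + t * I)
        (by simpa using ht) (by simp; linarith) (by simp; linarith)
      push_cast at this
      have e : 1 - ((1 : ℂ) - σ + t * I).re = σ := by simp
      simpa [e] using this
    have hz' : ‖riemannZeta (1 - σ + t * I)‖ ≤ 8 / ε * |t| ^ (σ + ε) := by
      refine hz.trans ?_
      have h0' : 0 ≤ |t| ^ σ := Real.rpow_nonneg ht0.le _
      calc 8 * |t| ^ σ * Real.log |t| ≤ 8 * |t| ^ σ * (|t| ^ ε / ε) := by gcongr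
        _ = 8 / ε * (|t| ^ σ * |t| ^ ε) := by ring
        _ = 8 / ε * |t| ^ (σ + ε) := by rw [← Real.rpow_add ht0]
    calc ‖riemannZeta w‖
        ≤ Real.exp (1 / 2) * (|t| / (2 * π)) ^ (1 / 2 - σ) * ‖riemannZeta (1 - σ + t * I)‖ := hfe
      _ ≤ Real.exp (1 / 2) * |t| ^ (1 / 2 - σ) * (8 / ε * |t| ^ (σ + ε)) := by gcongr
      _ = 8 * Real.exp (1 / 2) / ε * (|t| ^ (1 / 2 - σ) * |t| ^ (σ + ε)) := by ring
      _ = 8 * Real.exp (1 / 2) / ε * |t| ^ (1 / 2 + ε) := by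
          rw [← Real.rpow_add ht0]; ring_nf
      _ ≤ 9 * Real.exp (1 / 2) * (21 / ε) * |t| ^ (1 / 2 - σ₁ + ε) := by
          refine hbig _ (by linarith) _ (by positivity) ?_
          rw [show 9 * Real.exp (1 / 2) * (21 / ε) = (189 * Real.exp (1 / 2)) / ε by ring]
          exact div_le_div_of_nonneg_right (by linarith [Real.exp_pos (1 / 2)]) hε.le
  · -- `σ < 0`: `ζ(1-σ+it)` by Thm 3.5 (`1 - σ > 1`)
    have hz : ‖riemannZeta (1 - σ + t * I)‖ ≤ 21 * Real.log |t| := by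
      have him : (((1 - σ : ℝ) : ℂ) + t * I).im = t := by simp
      have hre : (((1 - σ : ℝ) : ℂ) + t * I).re = 1 - σ := by simp
      have := ZetaOneLine.norm_riemannZeta_le_log (s := (1 - σ : ℝ) + t * I)
        (by rw [him]; exact ht) (by
          rw [him, hre]
          have : 0 < 1 / (2 * Real.log |t|) := by positivity
          linarith)
      push_cast at this
      simpa using this
    have hz' : ‖riemannZeta (1 - σ + t * I)‖ ≤ 21 / ε * |t| ^ ε := by
      refine hz.trans ?_
      calc 21 * Real.log |t| ≤ 21 * (|t| ^ ε / ε) := by gcongr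
        _ = 21 / ε * |t| ^ ε := by ring
    calc ‖riemannZeta w‖
        ≤ Real.exp (1 / 2) * (|t| / (2 * π)) ^ (1 / 2 - σ) * ‖riemannZeta (1 - σ + t * I)‖ := hfe
      _ ≤ Real.exp (1 / 2) * |t| ^ (1 / 2 - σ) * (21 / ε * |t| ^ ε) := by gcongr
      _ = Real.exp (1 / 2) * (21 / ε) * (|t| ^ (1 / 2 - σ) * |t| ^ ε) := by ring
      _ = Real.exp (1 / 2) * (21 / ε) * |t| ^ (1 / 2 - σ + ε) := by
          rw [← Real.rpow_add ht0]
      _ ≤ 9 * Real.exp (1 / 2) * (21 / ε) * |t| ^ (1 / 2 - σ₁ + ε) := by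
          refine hbig _ (by linarith) _ (by positivity) ?_
          have hp : 0 < Real.exp (1 / 2) * (21 / ε) := by positivity
          linarith

/-- For `|y| ≥ 2` and `0 ≤ q ≤ 2`: `|y|^{-q} ≤ 4 (1+|y|)^{-q}`. [folklore] -/
private theorem abs_rpow_neg_le' {y q : ℝ} (hy : 2 ≤ |y|) (hq0 : 0 ≤ q) (hq : q ≤ 2) :
    |y| ^ (-q) ≤ 4 * (1 + |y|) ^ (-q) := by
  have hy0 : 0 < |y| := by linarith
  have h1 : 1 + |y| ≤ 2 * |y| := by linarith
  have h2 : (2 * |y|) ^ (-q) ≤ (1 + |y|) ^ (-q) := by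
    rw [Real.rpow_neg (by positivity), Real.rpow_neg (by positivity)]
    exact inv_anti₀ (Real.rpow_pos_of_pos (by positivity) _)
      (Real.rpow_le_rpow (by positivity) h1 hq0)
  rw [Real.mul_rpow (by norm_num) hy0.le] at h2
  have h3 : (1 / 4 : ℝ) ≤ (2 : ℝ) ^ (-q) := by
    rw [Real.rpow_neg (by norm_num)]
    have : (2 : ℝ) ^ q ≤ 2 ^ (2 : ℝ) := Real.rpow_le_rpow_of_exponent_le (by norm_num) hq
    have h4 : (2 : ℝ) ^ (2 : ℝ) = 4 := by norm_num
    rw [h4] at this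
    rw [one_div]
    exact inv_anti₀ (by positivity) this
  have h5 : 0 ≤ |y| ^ (-q) := Real.rpow_nonneg hy0.le _
  nlinarith

/-! ### The necessity half of Theorem B 2) -/

/-- **Verjovsky's Theorem B 2), necessity, for `C_c²(ℝ₊ˣ)`**: if `ζ(s) ≠ 0` for `re s > θ₀`
(`1/2 ≤ θ₀ < 1`), then for every `f ∈ C_c²(ℝ₊ˣ)` and `0 < ε ≤ (1−θ₀)/4`,
`m_y(f) − m₀(f) = O(y^{1−θ₀/2−ε})` as `y → 0⁺` (Mellin inversion of
`2f̃(2s)ζ(2s−1)/ζ(2s) − m₀/((s−1)s)`, holomorphic on `re s > θ₀/2`).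
[cite: Verjovsky1994, Thm B 2) p. 597 (second half; p. 604)] -/
theorem verjovskyRate_of_zeroFree {θ₀ : ℝ} (hθ : 1 / 2 ≤ θ₀) (hθ1 : θ₀ < 1)
    (hZ : ∀ s : ℂ, θ₀ < s.re → riemannZeta s ≠ 0) {f : ℝ → ℂ} (hf : IsVerjovskyTest 2 f)
    {ε : ℝ} (hε : 0 < ε) (hε1 : ε ≤ (1 - θ₀) / 4) :
    (fun y : ℝ ↦ verjovskyMeasure y f - verjovskyMean f) =O[𝓝[>] 0]
      fun y : ℝ ↦ y ^ (1 - θ₀ / 2 - ε) := by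
  have hε4 : ε ≤ 1 / 4 := by linarith
  have hQ : QuasiRiemannHypothesis θ₀ := fun s hs h1 _ ↦ hZ s h1 hs
  obtain ⟨hcd, hcs, hsupp⟩ := hf
  have hfc : Continuous f := hcd.continuous
  -- support `[a₀, b₀] ⊂ (0, ∞)`
  have h0 : (0 : ℝ) ∉ tsupport f := fun h ↦ lt_irrefl (0 : ℝ) (hsupp h)
  obtain ⟨δ, hδ, hδf⟩ := Metric.eventually_nhds_iff.1 (notMem_tsupport_iff_eventuallyEq.1 h0)
  obtain ⟨r₀, hr₀⟩ := (hcs.isCompact.isBounded).subset_closedBall (0 : ℝ)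
  set a₀ : ℝ := δ with ha₀
  set b₀ : ℝ := max r₀ 0 + 1 with hb₀
  have ha₀0 : 0 < a₀ := hδ
  have hfa : ∀ t, f t ≠ 0 → a₀ ≤ t := by
    intro t ht
    have htpos : 0 < t := hsupp (subset_tsupport f ht)
    by_contra h
    have : dist t 0 < δ := by
      rw [dist_zero_right, Real.norm_eq_abs, abs_of_pos htpos]; linarith
    exact ht (hδf this)
  have hfb : ∀ t, f t ≠ 0 → t ≤ b₀ := by
    intro t ht
    have h1 := hr₀ (subset_tsupport f ht)
    rw [Metric.mem_closedBall, dist_zero_right, Real.norm_eq_abs] at h1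
    have : t ≤ r₀ := (le_abs_self t).trans h1
    rw [hb₀]; linarith [le_max_left r₀ 0]
  have hb₀0 : 0 < b₀ := by rw [hb₀]; linarith [le_max_right r₀ 0]
  have hfR : ∀ t, b₀ + 1 ≤ t → f t = 0 := fun t ht ↦ by
    by_contra h; linarith [hfb t h]
  -- `V`, continuity, Mellin convergence on `re s = 1`
  set V : ℝ → ℂ := fun y ↦ verjovskyMeasure y f with hV
  set m₀ : ℂ := verjovskyMean f with hm₀
  have hVcont : ContinuousOn V (Ioi 0) := VerjovskyCriterion.continuousOn_verjovskyMeasure hfc hfR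
  have hVzero : ∀ y, (b₀ + 1) ^ 2 ≤ y → V y = 0 := fun y hy ↦
    VerjovskyCriterion.verjovskyMeasure_eq_zero_of_le (by linarith) hfR hy
  have hA := Verjovsky1994_thmA_holds f ⟨hcd.of_le (by norm_num), hcs, hsupp⟩
  have hVbdd : V =O[𝓝[>] 0] fun y : ℝ ↦ y ^ (-(0 : ℝ)) := by
    have h1 : (fun y : ℝ ↦ y ^ (1 / 2 : ℝ) * Real.log y) =O[𝓝[>] 0]
        fun y : ℝ ↦ y ^ (-(0 : ℝ)) := by
      refine IsBigO.of_bound 2 ?_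
      filter_upwards [Ioo_mem_nhdsGT (zero_lt_one' ℝ)] with y hy
      rw [neg_zero, Real.rpow_zero, Real.norm_eq_abs, Real.norm_eq_abs, abs_one, mul_one,
        mul_comm]
      have := Real.abs_log_mul_self_rpow_lt y (1 / 2) hy.1 hy.2.le (by norm_num)
      linarith
    have h2 : (fun _ : ℝ ↦ m₀) =O[𝓝[>] 0] fun y : ℝ ↦ y ^ (-(0 : ℝ)) := by
      refine IsBigO.of_bound ‖m₀‖ ?_
      filter_upwards with y
      simp
    have := (hA.trans h1).add h2
    simpa [hV, hm₀] using this
  have hVli : LocallyIntegrableOn V (Ioi 0) := hVcont.locallyIntegrableOn measurableSet_Ioi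
  have hVconv : ∀ y : ℝ, MellinConvergent V (1 + y * I) := by
    intro y
    refine mellinConvergent_of_isBigO_rpow (a := 2) (b := 0) hVli ?_ (by simp) hVbdd (by simp)
    refine (isBigO_zero _ _).congr' ?_ EventuallyEq.rfl
    filter_upwards [eventually_ge_atTop ((b₀ + 1) ^ 2)] with t ht
    exact (hVzero t ht).symm
  -- the analytic data
  set Mf : ℂ → ℂ := mellin f with hMf
  have hMfd : Differentiable ℂ Mf := differentiable_mellin_of_support hfc ha₀0 hfa hfb
  obtain ⟨M, hM0, hM⟩ := exists_norm_mellin_le_of_contDiff_two hcd ha₀0 hfa hfb (1 / 2) 4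
  -- `ζ(2s-1)`: unconditional growth with `σ₁ = θ₀ - 1 + 2ε ∈ [-1/2, 0]`
  obtain ⟨Cζ, hCζ, hζb⟩ := exists_norm_riemannZeta_le_uncond (σ₁ := θ₀ - 1 + 2 * ε)
    (by linarith) (by linarith) (ε := ε / 2) (by linarith) (by linarith)
  -- `1/ζ(2s)`: quasi-RH Littlewood, `σ ≥ θ₀ + 2ε`
  obtain ⟨T, hT⟩ := InvZetaQuasiRH.norm_inv_riemannZeta_le_rpow hQ hθ hθ1
    (σ₀ := θ₀ + 2 * ε) (by linarith) (ε := ε / 2) (by linarith)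
  set κ : ℂ := m₀ with hκ
  set Φ : ℂ → ℂ := fun s ↦ Mf (2 * s) * zetaReg (2 * s - 1) * (2 * s - 1) / zetaReg (2 * s)
    with hΦ
  set Ψ : ℂ → ℂ := fun s ↦ Φ s - κ / s with hΨ
  set U : Set ℂ := {s : ℂ | θ₀ / 2 < s.re} with hU
  have hUopen : IsOpen U := isOpen_lt continuous_const continuous_re
  have hzR : ∀ s ∈ U, zetaReg (2 * s) ≠ 0 := by
    intro s hs
    have hs' : θ₀ / 2 < s.re := hs
    by_cases h1 : 2 * s = 1
    · rw [h1, zetaReg, Function.update_self]; exact one_ne_zero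
    · rw [zetaReg_of_ne_one h1]
      refine mul_ne_zero (sub_ne_zero.2 h1) (hZ (2 * s) ?_)
      simp; linarith
  have hΦd : DifferentiableOn ℂ Φ U := by
    intro s hs
    apply DifferentiableAt.differentiableWithinAt
    have h1 : DifferentiableAt ℂ (fun s ↦ Mf (2 * s)) s :=
      (hMfd.comp (differentiable_id.const_mul (2 : ℂ))).differentiableAt
    have h2 : DifferentiableAt ℂ (fun s ↦ zetaReg (2 * s - 1)) s :=
      (differentiable_zetaReg.comp ((differentiable_id.const_mul (2 : ℂ)).sub_const 1)).differentiableAt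
    have h3 : DifferentiableAt ℂ (fun s : ℂ ↦ 2 * s - 1) s :=
      (differentiableAt_id.const_mul (2 : ℂ)).sub_const 1
    have h4 : DifferentiableAt ℂ (fun s ↦ zetaReg (2 * s)) s :=
      (differentiable_zetaReg.comp (differentiable_id.const_mul (2 : ℂ))).differentiableAt
    exact ((h1.mul h2).mul h3).div h4 (hzR s hs)
  have hΨd : DifferentiableOn ℂ Ψ U := by
    intro s hs
    have hs0 : s ≠ 0 := by
      intro h; have : θ₀ / 2 < s.re := hs; rw [h] at this; simp at this; linarith
    exact (hΦd s hs).sub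
      (((differentiableAt_const κ).div differentiableAt_id hs0).differentiableWithinAt)
  have h1U : (1 : ℂ) ∈ U := by show θ₀ / 2 < (1 : ℂ).re; simp; linarith
  have hGd : DifferentiableOn ℂ (dslope Ψ 1) U :=
    (Complex.differentiableOn_dslope (hUopen.mem_nhds h1U)).2 hΨd
  have hΦ1 : Φ 1 = κ := by
    have e1 : zetaReg (2 * (1 : ℂ) - 1) = 1 := by
      rw [show (2 : ℂ) * 1 - 1 = 1 by norm_num, zetaReg, Function.update_self]
    have e2 : zetaReg (2 * (1 : ℂ)) = riemannZeta 2 := by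
      rw [mul_one, zetaReg_of_ne_one (by norm_num : (2 : ℂ) ≠ 1)]; ring
    show mellin f (2 * 1) * zetaReg (2 * 1 - 1) * (2 * 1 - 1) / zetaReg (2 * 1) = verjovskyMean f
    rw [e1, e2, verjovskyMean_eq_mellin_two]
    norm_num
  have hΨ1 : Ψ 1 = 0 := by simp only [hΨ, hΦ1, div_one, sub_self]
  have hGeq : ∀ s : ℂ, 1 < s.re → dslope Ψ 1 s = mellin V (s - 1) - κ / ((s - 1) * s) := by
    intro s hs
    have hs1 : s ≠ 1 := by intro h; rw [h] at hs; simp at hs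
    have h2s1 : 2 * s - 1 ≠ 1 := by
      intro h; have := congrArg Complex.re h; simp at this; linarith
    have h2s : 2 * s ≠ 1 := by
      intro h; have := congrArg Complex.re h; simp at this; linarith
    have hLζ := LSeries_totient_mul_zeta (w := 2 * s) (by simp; linarith)
    have hmel : mellin V (s - 1) = 2 * Mf (2 * s) *
        LSeries (fun n ↦ (n.totient : ℂ)) (2 * s) := by
      have h := mellin_verjovskyMeasure_complex hfc ha₀0 hfa hfb (s := s - 1)
        (by simp; linarith)
      rw [show 2 * (s - 1) + 2 = 2 * s by ring] at h
      exact h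
    rw [dslope_of_ne _ hs1, slope_def_field, hΨ1, sub_zero, hmel]
    simp only [hΨ, hΦ]
    rw [zetaReg_of_ne_one h2s1, zetaReg_of_ne_one h2s, ← hLζ]
    have hsub1 : s - 1 ≠ 0 := sub_ne_zero.2 hs1
    have hs0 : s ≠ 0 := by intro h; rw [h] at hs; simp at hs; linarith
    have h2s1' : (2 : ℂ) * s - 1 ≠ 0 := by
      intro h; have := congrArg Complex.re h; simp at this; linarith
    have hζ2s : riemannZeta (2 * s) ≠ 0 :=
      riemannZeta_ne_zero_of_one_lt_re (by simp; linarith)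
    field_simp
    ring
  -- the exponents
  set A : ℝ := 1 / 2 - (θ₀ - 1 + 2 * ε) + ε / 2 with hAdef
  set r : ℝ := 1 / 2 + θ₀ + ε with hrdef
  have hr1 : 1 < r := by rw [hrdef]; linarith
  have hr2 : r ≤ 2 := by rw [hrdef]; linarith
  have hAr : -(2 : ℝ) + A + ε / 2 = -r := by rw [hAdef, hrdef]; ring
  have hA0 : 0 ≤ A + ε / 2 := by rw [hAdef]; linarith
  have hA2 : A + ε / 2 ≤ 2 := by rw [hAdef]; linarith
  -- the bound on the strip `θ₀/2 + ε ≤ re s ≤ 2`, `|im s| ≥ T₀`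
  set σ' : ℝ := θ₀ / 2 + ε with hσ'
  set T₀ : ℝ := max 2 (T / 2) with hT₀
  have hGb : ∀ x y : ℝ, x ∈ Icc σ' 2 → T₀ ≤ |y| →
      ‖dslope Ψ 1 (x + y * I)‖ ≤ (4 * (2 * M * Cζ + ‖κ‖)) * (1 + |y|) ^ (-r) := by
    intro x y hx hy
    have hy2 : 2 ≤ |y| := (le_max_left _ _).trans hy
    have hyT : T ≤ |2 * y| := by
      rw [abs_mul, abs_two]
      have := (le_max_right 2 (T / 2)).trans hy
      linarith
    set s : ℂ := x + y * I with hsdef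
    have hsre : s.re = x := by simp [hsdef]
    have hsim : s.im = y := by simp [hsdef]
    have hy0 : 0 < |y| := by linarith
    have hyne : y ≠ 0 := abs_pos.1 hy0
    have hs1 : s ≠ 1 := by
      intro h; have := congrArg Complex.im h; rw [hsim] at this; simp at this; exact hyne this
    have h2s1 : 2 * s - 1 ≠ 1 := by
      intro h; have := congrArg Complex.im h; simp [hsim] at this; exact hyne this
    have h2s : 2 * s ≠ 1 := by
      intro h; have := congrArg Complex.im h; simp [hsim] at this; exact hyne this
    have hζ2s : riemannZeta (2 * s) ≠ 0 := by
      have := hzR s (by show θ₀ / 2 < s.re; rw [hsre]; linarith [hx.1])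
      rw [zetaReg_of_ne_one h2s] at this
      exact right_ne_zero_of_mul this
    have hGs : dslope Ψ 1 s = 2 * Mf (2 * s) * riemannZeta (2 * s - 1) * (riemannZeta (2 * s))⁻¹ -
        κ / ((s - 1) * s) := by
      rw [dslope_of_ne _ hs1, slope_def_field, hΨ1, sub_zero]
      simp only [hΨ, hΦ]
      rw [zetaReg_of_ne_one h2s1, zetaReg_of_ne_one h2s]
      have hsub1 : s - 1 ≠ 0 := sub_ne_zero.2 hs1
      have h2s1' : (2 : ℂ) * s - 1 ≠ 0 := by
        intro h; have := congrArg Complex.im h; simp [hsim] at this; exact hyne this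
      have hs0 : s ≠ 0 := by
        intro h; have := congrArg Complex.im h; rw [hsim] at this; simp at this; exact hyne this
      field_simp
      ring
    have hA' : ‖Mf (2 * s)‖ ≤ M / 4 * |y| ^ (-(2 : ℝ)) := by
      have h := hM (2 * s) (by simp [hsre]; linarith [hx.1]) (by simp [hsre]; linarith [hx.2])
        (by simp [hsim]; exact hyne)
      have e : |(2 * s).im| = 2 * |y| := by simp [hsim, abs_mul]
      rw [e] at h
      refine h.trans (le_of_eq ?_)
      rw [Real.rpow_neg hy0.le, show (2 : ℝ) = (2 : ℕ) by norm_num, Real.rpow_natCast]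
      field_simp
      ring
    have hB : ‖riemannZeta (2 * s - 1)‖ ≤ Cζ * (2 * |y|) ^ A := by
      have h := hζb (2 * s - 1) (by simp [hsre]; linarith [hx.1])
        (by simp [hsim, abs_mul]; linarith)
      have e : |(2 * s - 1).im| = 2 * |y| := by simp [hsim, abs_mul]
      rw [e] at h
      exact h
    have hD : ‖(riemannZeta (2 * s))⁻¹‖ ≤ (2 * |y|) ^ (ε / 2) := by
      have h := hT (2 * x) (2 * y) (by linarith [hx.1]) hyT
      have e : ((2 * x : ℝ) : ℂ) + ((2 * y : ℝ) : ℂ) * I = 2 * s := by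
        simp [hsdef]; ring
      rw [e, abs_mul, abs_two] at h
      exact h
    have hpow : (2 * |y|) ^ A * (2 * |y|) ^ (ε / 2) ≤ 4 * |y| ^ (A + ε / 2) := by
      rw [← Real.rpow_add (by positivity), Real.mul_rpow (by norm_num) hy0.le]
      have : (2 : ℝ) ^ (A + ε / 2) ≤ 2 ^ (2 : ℝ) :=
        Real.rpow_le_rpow_of_exponent_le (by norm_num) hA2
      have h4 : (2 : ℝ) ^ (2 : ℝ) = 4 := by norm_num
      rw [h4] at this
      exact mul_le_mul_of_nonneg_right this (Real.rpow_nonneg hy0.le _)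
    have hmain : ‖2 * Mf (2 * s) * riemannZeta (2 * s - 1) * (riemannZeta (2 * s))⁻¹‖ ≤
        2 * M * Cζ * |y| ^ (-r) := by
      rw [norm_mul, norm_mul, norm_mul, Complex.norm_ofNat]
      have h0A : 0 ≤ M / 4 * |y| ^ (-(2 : ℝ)) := by positivity
      have h0B : 0 ≤ Cζ * (2 * |y|) ^ A := by positivity
      calc 2 * ‖Mf (2 * s)‖ * ‖riemannZeta (2 * s - 1)‖ * ‖(riemannZeta (2 * s))⁻¹‖
          ≤ 2 * (M / 4 * |y| ^ (-(2 : ℝ))) * (Cζ * (2 * |y|) ^ A) * (2 * |y|) ^ (ε / 2) := by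
            gcongr
        _ = M / 2 * Cζ * |y| ^ (-(2 : ℝ)) * ((2 * |y|) ^ A * (2 * |y|) ^ (ε / 2)) := by ring
        _ ≤ M / 2 * Cζ * |y| ^ (-(2 : ℝ)) * (4 * |y| ^ (A + ε / 2)) := by gcongr
        _ = 2 * M * Cζ * (|y| ^ (-(2 : ℝ)) * |y| ^ (A + ε / 2)) := by ring
        _ = 2 * M * Cζ * |y| ^ (-r) := by
            rw [← Real.rpow_add hy0, ← hAr]; ring_nf
    have hκs : ‖κ / ((s - 1) * s)‖ ≤ ‖κ‖ * |y| ^ (-r) := by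
      rw [norm_div, norm_mul]
      have h1 : |y| ≤ ‖s - 1‖ := by
        have := Complex.abs_im_le_norm (s - 1); simpa [hsim] using this
      have h2 : |y| ≤ ‖s‖ := by
        have := Complex.abs_im_le_norm s; simpa [hsim] using this
      have h3 : ‖κ‖ / (‖s - 1‖ * ‖s‖) ≤ ‖κ‖ / (|y| * |y|) := by gcongr
      refine h3.trans ?_
      have h4 : |y| * |y| = |y| ^ (2 : ℝ) := by
        rw [show (2 : ℝ) = (2 : ℕ) by norm_num, Real.rpow_natCast, sq]
      rw [h4, div_eq_mul_inv, ← Real.rpow_neg hy0.le]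
      exact mul_le_mul_of_nonneg_left
        (Real.rpow_le_rpow_of_exponent_le (by linarith) (by linarith)) (norm_nonneg _)
    have hq := abs_rpow_neg_le' (y := y) (q := r) hy2 (by linarith) hr2
    rw [hGs]
    calc ‖2 * Mf (2 * s) * riemannZeta (2 * s - 1) * (riemannZeta (2 * s))⁻¹ - κ / ((s - 1) * s)‖
        ≤ ‖2 * Mf (2 * s) * riemannZeta (2 * s - 1) * (riemannZeta (2 * s))⁻¹‖ +
          ‖κ / ((s - 1) * s)‖ := norm_sub_le _ _
      _ ≤ 2 * M * Cζ * |y| ^ (-r) + ‖κ‖ * |y| ^ (-r) := add_le_add hmain hκs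
      _ = (2 * M * Cζ + ‖κ‖) * |y| ^ (-r) := by ring
      _ ≤ (2 * M * Cζ + ‖κ‖) * (4 * (1 + |y|) ^ (-r)) := by gcongr
      _ = (4 * (2 * M * Cζ + ‖κ‖)) * (1 + |y|) ^ (-r) := by ring
  have hmain := isBigO_nhdsGT_zero_of_mellin_continuation_rpow (a := θ₀ / 2) (σ' := σ')
    (T₀ := T₀) (κ := κ) hVcont hVconv (by rw [hσ']; linarith) (by rw [hσ']; linarith)
    (by rw [hσ']; linarith) hGd hGeq hr1 hGb
  have e : 1 - σ' = 1 - θ₀ / 2 - ε := by rw [hσ']; ring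
  rw [e] at hmain
  simpa [hV, hκ, hm₀] using hmain

end VerjovskyNecessity

open VerjovskyNecessity in
/-- **Verjovsky 1994, Theorem B 2) — necessity half** (PROVED): for `1/2 < α < 3/4`, if `ζ(s) ≠ 0`
for `re s > 2(1−α)` then `m_y(f) − m₀(f) = O(y^{α−ε})` at `0⁺` for every `f ∈ C_c²(ℝ₊ˣ)` and
every `ε > 0`. [cite: Verjovsky1994, Thm B 2) p. 597 (second half, p. 604)] -/
theorem Verjovsky1994_thmB2.mp_holds {α : ℝ} (hα1 : 1 / 2 < α) (hα2 : α < 3 / 4)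
    (hZ : ∀ s : ℂ, 2 * (1 - α) < s.re → riemannZeta s ≠ 0) :
    ∀ f : ℝ → ℂ, IsVerjovskyTest 2 f → ∀ ε : ℝ, 0 < ε →
      (fun y : ℝ ↦ verjovskyMeasure y f - verjovskyMean f) =O[𝓝[>] 0]
        fun y : ℝ ↦ y ^ (α - ε) := by
  intro f hf ε hε
  set θ₀ : ℝ := 2 * (1 - α) with hθ₀
  set ε' : ℝ := min ε ((1 - θ₀) / 4) with hε'
  have hε'0 : 0 < ε' := lt_min hε (by rw [hθ₀]; linarith)
  have hε'1 : ε' ≤ (1 - θ₀) / 4 := min_le_right _ _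
  have hε'ε : ε' ≤ ε := min_le_left _ _
  have h := verjovskyRate_of_zeroFree (θ₀ := θ₀) (by rw [hθ₀]; linarith) (by rw [hθ₀]; linarith)
    hZ hf hε'0 hε'1
  have e : 1 - θ₀ / 2 - ε' = α - ε' := by rw [hθ₀]; ring
  rw [e] at h
  refine h.trans (IsBigO.of_bound 1 ?_)
  filter_upwards [Ioo_mem_nhdsGT (zero_lt_one' ℝ)] with y hy
  rw [one_mul, Real.norm_of_nonneg (Real.rpow_nonneg hy.1.le _),
    Real.norm_of_nonneg (Real.rpow_nonneg hy.1.le _)]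
  exact Real.rpow_le_rpow_of_exponent_ge hy.1 hy.2.le (by linarith)

/-- **Verjovsky 1994, Theorem B 2)** — the named fact `Verjovsky1994_thmB2` DISCHARGED: for
`1/2 < α < 3/4`, `ζ(s) ≠ 0` on `re s > 2(1−α)` iff `m_y(f) − m₀(f) = O(y^{α−ε})` at `0⁺` for every
`f ∈ C_c²(ℝ₊ˣ)` and every `ε > 0` (sufficiency: `Verjovsky1994_thmB2.mpr_holds`).
[cite: Verjovsky1994, Thm B 2) p. 597] -/
theorem Verjovsky1994_thmB2_holds : Verjovsky1994_thmB2 := fun _ hα1 hα2 ↦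
  ⟨fun hZ ↦ Verjovsky1994_thmB2.mp_holds hα1 hα2 hZ,
    fun h ↦ Verjovsky1994_thmB2.mpr_holds hα1 hα2 h⟩

/-! ### Theorem B for every class `C_c^r(ℝ₊ˣ)`, `r ≥ 2` (as printed) -/

/-- **Verjovsky 1994, Theorem B 2) for every class `C_c^r(ℝ₊ˣ)`, `r ≥ 2`** (as printed: "for all
functions `f ∈ C_c^r(ℝ*)`", `r ≥ 2` by §3 p. 603), PROVED: for `1/2 < α < 3/4`, `ζ(s) ≠ 0` on
`re s > 2(1−α)` iff `m_y(f) − m₀(f) = O(y^{α−ε})` at `0⁺` for every `f ∈ C_c^r(ℝ₊ˣ)` and every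
`ε > 0` (`→`: a `C^r` test function is `C²`; `←`: `riemannZeta_ne_zero_of_verjovskyRate_of_class`).
[cite: Verjovsky1994, Thm B 2) p. 597 (classes C_c^r, r ≥ 2)] -/
theorem verjovsky_thmB2_iff_of_class {r : ℕ} (hr : 2 ≤ r) {α : ℝ} (hα1 : 1 / 2 < α)
    (hα2 : α < 3 / 4) :
    (∀ s : ℂ, 2 * (1 - α) < s.re → riemannZeta s ≠ 0) ↔
      ∀ f : ℝ → ℂ, IsVerjovskyTest r f → ∀ ε : ℝ, 0 < ε →
        (fun y : ℝ ↦ verjovskyMeasure y f - verjovskyMean f) =O[𝓝[>] 0]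
          fun y : ℝ ↦ y ^ (α - ε) := by
  constructor
  · intro hZ f hf ε hε
    exact Verjovsky1994_thmB2.mp_holds hα1 hα2 hZ f
      ⟨hf.1.of_le (by exact_mod_cast hr), hf.2.1, hf.2.2⟩ ε hε
  · intro h s hs
    exact VerjovskyCriterion.riemannZeta_ne_zero_of_verjovskyRate_of_class r (by linarith) (by linarith) h hs

/-- **Verjovsky 1994, Theorem B 1) for every class `C_c^r(ℝ₊ˣ)`, `r ≥ 2`**, PROVED: RH holds iff
`m_y(f) − m₀(f) = o(y^{3/4−ε})` at `0⁺` for every `f ∈ C_c^r(ℝ₊ˣ)` and every `ε > 0`.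
[cite: Verjovsky1994, Thm B 1) p. 597 (classes C_c^r, r ≥ 2)] -/
theorem verjovsky_thmB1_iff_of_class {r : ℕ} (hr : 2 ≤ r) :
    RiemannHypothesis ↔
      ∀ f : ℝ → ℂ, IsVerjovskyTest r f → ∀ ε : ℝ, 0 < ε →
        (fun y : ℝ ↦ verjovskyMeasure y f - verjovskyMean f) =o[𝓝[>] 0]
          fun y : ℝ ↦ y ^ (3 / 4 - ε) := by
  constructor
  · intro hRH f hf ε hε
    exact Verjovsky1994_thmB1.mp_holds hRH f ⟨hf.1.of_le (by exact_mod_cast hr), hf.2.1, hf.2.2⟩ ε hε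
  · intro h
    refine quasiRiemannHypothesis_one_half_iff_holds.1 fun s hs h1 _ ↦ ?_
    exact VerjovskyCriterion.riemannZeta_ne_zero_of_verjovskyRate_of_class r (α := 3 / 4) (by norm_num)
      (by norm_num) (fun f hf ε hε ↦ (h f hf ε hε).isBigO) (by linarith) hs

end Literature.NumberTheory.LFunctions
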